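import Summits.HubbardSuperconductivity.HubbardSuperconductivity.Theorems.InfiniteVolumeFirstCoarseTightnessBlockModes
import Literature.MathematicalPhysics.QuantumLattice.FreeFermiGasPairGramBounds

/-!
# Block pair Gram bound (abstract): `‖(Σ_j κ_j c_↑(φ_j)c_↓(φ_j)) ψ‖² ≤ κ₀² (Σ_j x_j + (Σ_j t_j)²)`

Support for the cruxes `NoInfraredPileUp` (stmt-HubbardSuperconductivity-18534) and
`NoNormalLimitState` (stmt-HubbardSuperconductivity-18533) of route `InfiniteVolumeFirst`: steps
S3+S4 of the coarse-tightness / atom-ceiling programme (`PLAN-coarse-tightness.md` attached to the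
item) — the LOCAL (block) version of the pair Gram bounds of
`Literature/MathematicalPhysics/QuantumLattice/FreeFermiGasPairGramBounds.lean`, feeding the
mesoscopic pair-order ceiling `(L²R⁴)⁻¹ Σ_a ‖B_a ψ‖²` of weak-coupling Hubbard ground states.

This file (2/4): the Gram bounds for the block pairs `b_j = c_↑(φ_j) c_↓(φ_j)` of a real orthonormal
family along two injective orbital maps with disjoint ranges — `u_j ∈ [0, x_j]`, `v_j ∈ [0, 1 - x_j]`,
Cauchy–Schwarz both ways on `⟨b_j ψ, b_{j'} ψ⟩`, geometric mean — and the ABSTRACT BLOCK PAIR GRAM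
BOUND `re_star_sum_smul_pair_mulVec_le`: for unit `ψ` and `|κ_j| ≤ κ₀`,
`‖(Σ_j κ_j b_j) ψ‖² ≤ κ₀² (Σ_j x_j + (Σ_j (x_j(1-x_j))^{1/4})²)`, `x_j = ⟨n_↑(φ_j)⟩` — verbatim the
torus argument of `FreeFermiGasPairGramBounds` with plane waves replaced by block modes.
Registered stub: `stub_coarseBlockModesGramBound` (the torus block maps).

Sources: J. Bardeen, L. N. Cooper, J. R. Schrieffer, Phys. Rev. 108 (1957) 1175, §II;
C. N. Yang, Rev. Mod. Phys. 34 (1962) 694, §3; O. Bratteli, D. W. Robinson, *Operator Algebras and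
Quantum Statistical Mechanics II* §5.2.2 (`a(f)`); D. J. Scalapino, Phys. Rep. 250 (1995) 329, §2.
Folklore finite-dimensional statements; no definition and no named fact is introduced.
-/


noncomputable section

-- the mandated namespace `Summit.<Summit>.<Problem>.Theorems` repeats `HubbardSuperconductivity`
-- (single-problem summit, D-0017), which the `dupNamespace` linter flags on every declaration
set_option linter.dupNamespace false

namespace Summit.HubbardSuperconductivity.HubbardSuperconductivity.Theorems.CoarseTightness

open Literature.MathematicalPhysics.QuantumLattice Literature.Probability.LatticeModels Matrix Finset
open Literature.MathematicalPhysics.QuantumLattice.RayleighBound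
open scoped ComplexConjugate ComplexOrder

/-! ### Gram bounds for the block pairs -/

section Gram

variable {ι : Type*} [LinearOrder ι] [Fintype ι] {U : Type*} [Fintype U] [DecidableEq U]
  {J : Type*} [DecidableEq J]
  {ωu ωd : U → ι} (hωu : Function.Injective ωu) (hωd : Function.Injective ωd)
  (hdis : ∀ u v, ωu u ≠ ωd v) (φ : J → U → ℝ)
  (hON : ∀ j j', ∑ u, φ j u * φ j' u = if j = j' then 1 else 0)

include hωu hON in
/-- `n_↑(φ_j)` is a Hermitian idempotent. [folklore] -/
theorem proj_modeUp (j : J) :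
    (numberMode (Function.extend ωu (fun u => ((φ j u : ℝ) : ℂ)) 0))ᴴ =
        numberMode (Function.extend ωu (fun u => ((φ j u : ℝ) : ℂ)) 0) ∧
      numberMode (Function.extend ωu (fun u => ((φ j u : ℝ) : ℂ)) 0) *
          numberMode (Function.extend ωu (fun u => ((φ j u : ℝ) : ℂ)) 0) =
        numberMode (Function.extend ωu (fun u => ((φ j u : ℝ) : ℂ)) 0) :=
  ⟨numberMode_conjTranspose _, numberMode_mul_self (star_mode_dotProduct_self hωu φ hON j)⟩

include hωu hωd hdis hON in
/-- `n_↓(φ_j) n_↑(φ_j)` is a Hermitian idempotent, equal to `n_↑(φ_j) n_↓(φ_j)`. [folklore] -/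
theorem proj_modeDown_mul_modeUp (j : J) :
    (numberMode (Function.extend ωd (fun u => ((φ j u : ℝ) : ℂ)) 0) *
        numberMode (Function.extend ωu (fun u => ((φ j u : ℝ) : ℂ)) 0))ᴴ =
        numberMode (Function.extend ωd (fun u => ((φ j u : ℝ) : ℂ)) 0) *
          numberMode (Function.extend ωu (fun u => ((φ j u : ℝ) : ℂ)) 0) ∧
      numberMode (Function.extend ωd (fun u => ((φ j u : ℝ) : ℂ)) 0) *
            numberMode (Function.extend ωu (fun u => ((φ j u : ℝ) : ℂ)) 0) *
          (numberMode (Function.extend ωd (fun u => ((φ j u : ℝ) : ℂ)) 0) *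
            numberMode (Function.extend ωu (fun u => ((φ j u : ℝ) : ℂ)) 0)) =
        numberMode (Function.extend ωd (fun u => ((φ j u : ℝ) : ℂ)) 0) *
          numberMode (Function.extend ωu (fun u => ((φ j u : ℝ) : ℂ)) 0) ∧
      numberMode (Function.extend ωd (fun u => ((φ j u : ℝ) : ℂ)) 0) *
          numberMode (Function.extend ωu (fun u => ((φ j u : ℝ) : ℂ)) 0) =
        numberMode (Function.extend ωu (fun u => ((φ j u : ℝ) : ℂ)) 0) *
          numberMode (Function.extend ωd (fun u => ((φ j u : ℝ) : ℂ)) 0) := by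
  have hc : numberMode (Function.extend ωd (fun u => ((φ j u : ℝ) : ℂ)) 0) *
      numberMode (Function.extend ωu (fun u => ((φ j u : ℝ) : ℂ)) 0) =
      numberMode (Function.extend ωu (fun u => ((φ j u : ℝ) : ℂ)) 0) *
        numberMode (Function.extend ωd (fun u => ((φ j u : ℝ) : ℂ)) 0) :=
    numberMode_mul_numberMode_of_orthogonal (star_modeDown_dotProduct_modeUp hdis φ j j)
  obtain ⟨h1, h2⟩ := proj_mul_proj_of_commute (numberMode_conjTranspose _)
    (numberMode_mul_self (star_mode_dotProduct_self hωd φ hON j)) (numberMode_conjTranspose _)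
    (numberMode_mul_self (star_mode_dotProduct_self hωu φ hON j)) hc
  exact ⟨h1, h2, hc⟩

include hωu hωd hdis hON in
/-- `0 ≤ u_j = Re ⟨ψ, n_↓(φ_j) n_↑(φ_j) ψ⟩ ≤ x_j = Re ⟨ψ, n_↑(φ_j) ψ⟩`. [folklore] -/
theorem re_expect_blockPairPresent_mem_Icc (j : J) (ψ : Fock ι) :
    (star ψ ⬝ᵥ ((numberMode (Function.extend ωd (fun u => ((φ j u : ℝ) : ℂ)) 0) *
        numberMode (Function.extend ωu (fun u => ((φ j u : ℝ) : ℂ)) 0)) *ᵥ ψ)).re ∈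
      Set.Icc 0 (star ψ ⬝ᵥ (numberMode (Function.extend ωu (fun u => ((φ j u : ℝ) : ℂ)) 0) *ᵥ ψ)).re := by
  obtain ⟨h1, h2, hc⟩ := proj_modeDown_mul_modeUp hωu hωd hdis φ hON j
  refine ⟨Literature.Computability.AlgebraicComplexity.re_dotProduct_mulVec_nonneg
      (show Matrix.IsHermitian _ from h1) h2 ψ, ?_⟩
  rw [hc]
  exact re_expect_mul_le_of_commute_proj (numberMode_conjTranspose _)
    (numberMode_mul_self (star_mode_dotProduct_self hωu φ hON j)) (numberMode_conjTranspose _)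
    (numberMode_mul_self (star_mode_dotProduct_self hωd φ hON j)) hc.symm ψ

include hωu hωd hdis hON in
/-- `0 ≤ v_j = Re ⟨ψ, (1 - n_↓(φ_j))(1 - n_↑(φ_j)) ψ⟩ ≤ Re ⟨ψ, ψ⟩ - x_j`. [folklore] -/
theorem re_expect_blockPairAbsent_mem_Icc (j : J) (ψ : Fock ι) :
    (star ψ ⬝ᵥ (((1 - numberMode (Function.extend ωd (fun u => ((φ j u : ℝ) : ℂ)) 0)) *
        (1 - numberMode (Function.extend ωu (fun u => ((φ j u : ℝ) : ℂ)) 0))) *ᵥ ψ)).re ∈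
      Set.Icc 0 ((star ψ ⬝ᵥ ψ).re -
        (star ψ ⬝ᵥ (numberMode (Function.extend ωu (fun u => ((φ j u : ℝ) : ℂ)) 0) *ᵥ ψ)).re) := by
  obtain ⟨_, _, hc⟩ := proj_modeDown_mul_modeUp hωu hωd hdis φ hON j
  obtain ⟨hU1, hU2⟩ := proj_modeUp hωu φ hON j
  have hD1 : (numberMode (Function.extend ωd (fun u => ((φ j u : ℝ) : ℂ)) 0))ᴴ =
      numberMode (Function.extend ωd (fun u => ((φ j u : ℝ) : ℂ)) 0) := numberMode_conjTranspose _
  have hD2 := numberMode_mul_self (star_mode_dotProduct_self hωd φ hON j)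
  obtain ⟨hU1', hU2'⟩ := Literature.Computability.AlgebraicComplexity.one_sub_proj
    (show Matrix.IsHermitian _ from hU1) hU2
  obtain ⟨hD1', hD2'⟩ := Literature.Computability.AlgebraicComplexity.one_sub_proj
    (show Matrix.IsHermitian _ from hD1) hD2
  have hc' : Commute (1 - numberMode (Function.extend ωu (fun u => ((φ j u : ℝ) : ℂ)) 0))
      (1 - numberMode (Function.extend ωd (fun u => ((φ j u : ℝ) : ℂ)) 0)) :=
    (Commute.one_right _).sub_right ((Commute.one_left _).sub_left hc.symm)
  have hcomm : (1 - numberMode (Function.extend ωd (fun u => ((φ j u : ℝ) : ℂ)) 0)) *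
      (1 - numberMode (Function.extend ωu (fun u => ((φ j u : ℝ) : ℂ)) 0)) =
      (1 - numberMode (Function.extend ωu (fun u => ((φ j u : ℝ) : ℂ)) 0)) *
        (1 - numberMode (Function.extend ωd (fun u => ((φ j u : ℝ) : ℂ)) 0)) := hc'.eq.symm
  rw [hcomm]
  obtain ⟨h1, h2⟩ := proj_mul_proj_of_commute hU1' hU2' hD1' hD2' hc'
  refine ⟨Literature.Computability.AlgebraicComplexity.re_dotProduct_mulVec_nonneg
      (show Matrix.IsHermitian _ from h1) h2 ψ, ?_⟩
  have h := re_expect_mul_le_of_commute_proj hU1' hU2' hD1' hD2' hc' ψ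
  rw [sub_mulVec, one_mulVec, dotProduct_sub, Complex.sub_re] at h
  exact h

omit [DecidableEq U] [DecidableEq J] in
include hdis in
/-- **First Gram bound**: `‖⟨ψ, b_j† b_{j'} ψ⟩‖² ≤ u_j u_{j'}` (Cauchy–Schwarz on
`⟨b_j ψ, b_{j'} ψ⟩`, `‖b_j ψ‖² = u_j`). Yang (1962) §3. [folklore] -/
theorem norm_blockPairCorrelation_sq_le_present (j j' : J) (ψ : Fock ι) :
    ‖star ψ ⬝ᵥ (((annihilate (Function.extend ωu (fun u => ((φ j u : ℝ) : ℂ)) 0) *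
          annihilate (Function.extend ωd (fun u => ((φ j u : ℝ) : ℂ)) 0))ᴴ *
        (annihilate (Function.extend ωu (fun u => ((φ j' u : ℝ) : ℂ)) 0) *
          annihilate (Function.extend ωd (fun u => ((φ j' u : ℝ) : ℂ)) 0))) *ᵥ ψ)‖ ^ 2 ≤
      (star ψ ⬝ᵥ ((numberMode (Function.extend ωd (fun u => ((φ j u : ℝ) : ℂ)) 0) *
          numberMode (Function.extend ωu (fun u => ((φ j u : ℝ) : ℂ)) 0)) *ᵥ ψ)).re *
        (star ψ ⬝ᵥ ((numberMode (Function.extend ωd (fun u => ((φ j' u : ℝ) : ℂ)) 0) *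
          numberMode (Function.extend ωu (fun u => ((φ j' u : ℝ) : ℂ)) 0)) *ᵥ ψ)).re := by
  rw [star_dotProduct_conjTranspose_mul_mulVec, ← conjTranspose_pair_mul_self hdis φ j,
    ← conjTranspose_pair_mul_self hdis φ j', star_dotProduct_conjTranspose_mul_mulVec,
    star_dotProduct_conjTranspose_mul_mulVec]
  exact norm_star_dotProduct_sq_le _ _

include hωu hωd hdis hON in
/-- **Second Gram bound** (`j ≠ j'`): `‖⟨ψ, b_j† b_{j'} ψ⟩‖² ≤ v_{j'} v_j` (write
`b_j† b_{j'} = b_{j'} b_j†` and Cauchy–Schwarz on `⟨b_{j'}† ψ, b_j† ψ⟩`, `‖b_j† ψ‖² = v_j`).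
Yang (1962) §3. [folklore] -/
theorem norm_blockPairCorrelation_sq_le_absent {j j' : J} (h : j ≠ j') (ψ : Fock ι) :
    ‖star ψ ⬝ᵥ (((annihilate (Function.extend ωu (fun u => ((φ j u : ℝ) : ℂ)) 0) *
          annihilate (Function.extend ωd (fun u => ((φ j u : ℝ) : ℂ)) 0))ᴴ *
        (annihilate (Function.extend ωu (fun u => ((φ j' u : ℝ) : ℂ)) 0) *
          annihilate (Function.extend ωd (fun u => ((φ j' u : ℝ) : ℂ)) 0))) *ᵥ ψ)‖ ^ 2 ≤
      (star ψ ⬝ᵥ (((1 - numberMode (Function.extend ωd (fun u => ((φ j' u : ℝ) : ℂ)) 0)) *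
          (1 - numberMode (Function.extend ωu (fun u => ((φ j' u : ℝ) : ℂ)) 0))) *ᵥ ψ)).re *
        (star ψ ⬝ᵥ (((1 - numberMode (Function.extend ωd (fun u => ((φ j u : ℝ) : ℂ)) 0)) *
          (1 - numberMode (Function.extend ωu (fun u => ((φ j u : ℝ) : ℂ)) 0))) *ᵥ ψ)).re := by
  rw [conjTranspose_pair_mul_pair_of_ne hωu hωd hdis φ hON h,
    ← pair_mul_conjTranspose_self hωu hωd hdis φ hON j',
    ← pair_mul_conjTranspose_self hωu hωd hdis φ hON j]
  set B := annihilate (Function.extend ωu (fun u => ((φ j u : ℝ) : ℂ)) 0) *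
    annihilate (Function.extend ωd (fun u => ((φ j u : ℝ) : ℂ)) 0)
  set B' := annihilate (Function.extend ωu (fun u => ((φ j' u : ℝ) : ℂ)) 0) *
    annihilate (Function.extend ωd (fun u => ((φ j' u : ℝ) : ℂ)) 0)
  have e1 : B' * Bᴴ = (B'ᴴ)ᴴ * Bᴴ := by rw [conjTranspose_conjTranspose]
  have e2 : B' * B'ᴴ = (B'ᴴ)ᴴ * B'ᴴ := by rw [conjTranspose_conjTranspose]
  have e3 : B * Bᴴ = (Bᴴ)ᴴ * Bᴴ := by rw [conjTranspose_conjTranspose]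
  rw [e1, e2, e3, star_dotProduct_conjTranspose_mul_mulVec, star_dotProduct_conjTranspose_mul_mulVec,
    star_dotProduct_conjTranspose_mul_mulVec]
  exact norm_star_dotProduct_sq_le _ _

include hωu hωd hdis hON in
/-- **Block pair Gram bound, two-point form**: for `j ≠ j'`, `‖⟨ψ, b_j† b_{j'} ψ⟩‖ ≤ t_j t_{j'}`
with `t_q = (u_q v_q)^{1/4}` (geometric mean of the two Gram bounds). [folklore] -/
theorem norm_blockPairCorrelation_le_mul {j j' : J} (h : j ≠ j') (ψ : Fock ι) :
    ‖star ψ ⬝ᵥ (((annihilate (Function.extend ωu (fun u => ((φ j u : ℝ) : ℂ)) 0) *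
          annihilate (Function.extend ωd (fun u => ((φ j u : ℝ) : ℂ)) 0))ᴴ *
        (annihilate (Function.extend ωu (fun u => ((φ j' u : ℝ) : ℂ)) 0) *
          annihilate (Function.extend ωd (fun u => ((φ j' u : ℝ) : ℂ)) 0))) *ᵥ ψ)‖ ≤
      Real.sqrt (Real.sqrt
        ((star ψ ⬝ᵥ ((numberMode (Function.extend ωd (fun u => ((φ j u : ℝ) : ℂ)) 0) *
            numberMode (Function.extend ωu (fun u => ((φ j u : ℝ) : ℂ)) 0)) *ᵥ ψ)).re *
          (star ψ ⬝ᵥ (((1 - numberMode (Function.extend ωd (fun u => ((φ j u : ℝ) : ℂ)) 0)) *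
            (1 - numberMode (Function.extend ωu (fun u => ((φ j u : ℝ) : ℂ)) 0))) *ᵥ ψ)).re)) *
      Real.sqrt (Real.sqrt
        ((star ψ ⬝ᵥ ((numberMode (Function.extend ωd (fun u => ((φ j' u : ℝ) : ℂ)) 0) *
            numberMode (Function.extend ωu (fun u => ((φ j' u : ℝ) : ℂ)) 0)) *ᵥ ψ)).re *
          (star ψ ⬝ᵥ (((1 - numberMode (Function.extend ωd (fun u => ((φ j' u : ℝ) : ℂ)) 0)) *
            (1 - numberMode (Function.extend ωu (fun u => ((φ j' u : ℝ) : ℂ)) 0))) *ᵥ ψ)).re)) := by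
  have hu := (re_expect_blockPairPresent_mem_Icc hωu hωd hdis φ hON j ψ).1
  have hu' := (re_expect_blockPairPresent_mem_Icc hωu hωd hdis φ hON j' ψ).1
  have hv := (re_expect_blockPairAbsent_mem_Icc hωu hωd hdis φ hON j ψ).1
  have hv' := (re_expect_blockPairAbsent_mem_Icc hωu hωd hdis φ hON j' ψ).1
  have h1 := norm_blockPairCorrelation_sq_le_present hdis φ j j' ψ
  have h2 := norm_blockPairCorrelation_sq_le_absent hωu hωd hdis φ hON h ψ
  -- from `m² ≤ A`, `m² ≤ B` (`m, A ≥ 0`): `m ≤ √(√(A·B))`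
  have le_sqrt_sqrt_of_sq_le : ∀ {m A B : ℝ}, 0 ≤ m → 0 ≤ A → m ^ 2 ≤ A → m ^ 2 ≤ B →
      m ≤ Real.sqrt (Real.sqrt (A * B)) := by
    intro m A B hm hA h1 h2
    have h4 : (m ^ 2) ^ 2 ≤ A * B := by
      rw [sq (m ^ 2)]
      exact mul_le_mul h1 h2 (sq_nonneg _) hA
    have h5 : m ^ 2 ≤ Real.sqrt (A * B) := by
      rw [← Real.sqrt_sq (sq_nonneg m)]
      exact Real.sqrt_le_sqrt h4
    rw [← Real.sqrt_sq hm]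
    exact Real.sqrt_le_sqrt h5
  generalize (star ψ ⬝ᵥ ((numberMode (Function.extend ωd (fun u => ((φ j u : ℝ) : ℂ)) 0) *
      numberMode (Function.extend ωu (fun u => ((φ j u : ℝ) : ℂ)) 0)) *ᵥ ψ)).re = A at *
  generalize (star ψ ⬝ᵥ ((numberMode (Function.extend ωd (fun u => ((φ j' u : ℝ) : ℂ)) 0) *
      numberMode (Function.extend ωu (fun u => ((φ j' u : ℝ) : ℂ)) 0)) *ᵥ ψ)).re = A' at *
  generalize (star ψ ⬝ᵥ (((1 - numberMode (Function.extend ωd (fun u => ((φ j u : ℝ) : ℂ)) 0)) *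
      (1 - numberMode (Function.extend ωu (fun u => ((φ j u : ℝ) : ℂ)) 0))) *ᵥ ψ)).re = V at *
  generalize (star ψ ⬝ᵥ (((1 - numberMode (Function.extend ωd (fun u => ((φ j' u : ℝ) : ℂ)) 0)) *
      (1 - numberMode (Function.extend ωu (fun u => ((φ j' u : ℝ) : ℂ)) 0))) *ᵥ ψ)).re = V' at *
  rw [← Real.sqrt_mul (Real.sqrt_nonneg _), ← Real.sqrt_mul (mul_nonneg hu hv),
    show A * V * (A' * V') = A * A' * (V' * V) by ring]
  exact le_sqrt_sqrt_of_sq_le (norm_nonneg _) (mul_nonneg hu hu') h1 h2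


include hωu hωd hdis hON in
/-- **Abstract block pair Gram bound.** For a unit vector `ψ`, real weights `|κ_j| ≤ κ₀` and the
block pairs `b_j = c_↑(φ_j) c_↓(φ_j)` of a real orthonormal family:
`‖(Σ_j κ_j b_j) ψ‖² ≤ κ₀² (Σ_j x_j + (Σ_j T_j)²)` with `x_j = ⟨n_↑(φ_j)⟩` and
`T_j = (x_j (1 - x_j))^{1/4}` (diagonal terms `≤ u_j ≤ x_j`, off-diagonal terms `≤ t_j t_{j'}`,
`t_j⁴ = u_j v_j ≤ x_j (1 - x_j)`). Bardeen–Cooper–Schrieffer (1957) §II; Yang (1962) §3. [folklore] -/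
theorem re_star_sum_smul_pair_mulVec_le [Fintype J] (κ : J → ℝ) (κ₀ : ℝ) (hκ : ∀ j, |κ j| ≤ κ₀)
    (ψ : Fock ι) (hψ : star ψ ⬝ᵥ ψ = 1) :
    (star ((∑ j, (κ j : ℂ) • (annihilate (Function.extend ωu (fun u => ((φ j u : ℝ) : ℂ)) 0) *
        annihilate (Function.extend ωd (fun u => ((φ j u : ℝ) : ℂ)) 0))) *ᵥ ψ) ⬝ᵥ
      ((∑ j, (κ j : ℂ) • (annihilate (Function.extend ωu (fun u => ((φ j u : ℝ) : ℂ)) 0) *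
        annihilate (Function.extend ωd (fun u => ((φ j u : ℝ) : ℂ)) 0))) *ᵥ ψ)).re ≤
      κ₀ ^ 2 * ((∑ j, (star ψ ⬝ᵥ
          (numberMode (Function.extend ωu (fun u => ((φ j u : ℝ) : ℂ)) 0) *ᵥ ψ)).re) +
        (∑ j, Real.sqrt (Real.sqrt
          ((star ψ ⬝ᵥ (numberMode (Function.extend ωu (fun u => ((φ j u : ℝ) : ℂ)) 0) *ᵥ ψ)).re *
            (1 - (star ψ ⬝ᵥ
              (numberMode (Function.extend ωu (fun u => ((φ j u : ℝ) : ℂ)) 0) *ᵥ ψ)).re)))) ^ 2) := by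
  -- abbreviations
  set b : J → Matrix (Finset ι) (Finset ι) ℂ := fun j =>
    annihilate (Function.extend ωu (fun u => ((φ j u : ℝ) : ℂ)) 0) *
      annihilate (Function.extend ωd (fun u => ((φ j u : ℝ) : ℂ)) 0) with hb
  set x : J → ℝ := fun j => (star ψ ⬝ᵥ
    (numberMode (Function.extend ωu (fun u => ((φ j u : ℝ) : ℂ)) 0) *ᵥ ψ)).re with hx
  set uu : J → ℝ := fun j => (star ψ ⬝ᵥ
    ((numberMode (Function.extend ωd (fun u => ((φ j u : ℝ) : ℂ)) 0) *
      numberMode (Function.extend ωu (fun u => ((φ j u : ℝ) : ℂ)) 0)) *ᵥ ψ)).re with huu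
  set vv : J → ℝ := fun j => (star ψ ⬝ᵥ
    (((1 - numberMode (Function.extend ωd (fun u => ((φ j u : ℝ) : ℂ)) 0)) *
      (1 - numberMode (Function.extend ωu (fun u => ((φ j u : ℝ) : ℂ)) 0))) *ᵥ ψ)).re with hvv
  set t : J → ℝ := fun j => Real.sqrt (Real.sqrt (uu j * vv j)) with ht
  set T : J → ℝ := fun j => Real.sqrt (Real.sqrt (x j * (1 - x j))) with hT
  have ht0 : ∀ j, 0 ≤ t j := fun j => Real.sqrt_nonneg _
  have hT0 : ∀ j, 0 ≤ T j := fun j => Real.sqrt_nonneg _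
  have hu0 : ∀ j, 0 ≤ uu j := fun j => (re_expect_blockPairPresent_mem_Icc hωu hωd hdis φ hON j ψ).1
  have hux : ∀ j, uu j ≤ x j := fun j => (re_expect_blockPairPresent_mem_Icc hωu hωd hdis φ hON j ψ).2
  have hv0 : ∀ j, 0 ≤ vv j := fun j => (re_expect_blockPairAbsent_mem_Icc hωu hωd hdis φ hON j ψ).1
  have hvx : ∀ j, vv j ≤ 1 - x j := fun j => by
    have h := (re_expect_blockPairAbsent_mem_Icc hωu hωd hdis φ hON j ψ).2
    rw [hψ, Complex.one_re] at h
    exact h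
  have htT : ∀ j, t j ≤ T j := fun j =>
    Real.sqrt_le_sqrt (Real.sqrt_le_sqrt (mul_le_mul (hux j) (hvx j) (hv0 j)
      ((hu0 j).trans (hux j))))
  have hκ0 : ∀ j, 0 ≤ κ₀ := fun j => (abs_nonneg _).trans (hκ j)
  -- `⟨Zψ, Zψ⟩ = Σ_{j,j'} κ_j κ_{j'} ⟨ψ, b_j† b_{j'} ψ⟩`
  have hexp : star ((∑ j, (κ j : ℂ) • b j) *ᵥ ψ) ⬝ᵥ ((∑ j, (κ j : ℂ) • b j) *ᵥ ψ) =
      ∑ j, ∑ j', ((κ j : ℂ) * (κ j' : ℂ)) * (star ψ ⬝ᵥ (((b j)ᴴ * b j') *ᵥ ψ)) := by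
    rw [← star_dotProduct_conjTranspose_mul_mulVec, conjTranspose_sum, Finset.sum_mul_sum]
    simp only [Matrix.sum_mulVec, dotProduct_sum]
    refine Finset.sum_congr rfl fun j _ => Finset.sum_congr rfl fun j' _ => ?_
    rw [conjTranspose_smul, smul_mul_smul_comm, Matrix.smul_mulVec, dotProduct_smul, smul_eq_mul,
      Complex.star_def, Complex.conj_ofReal]
  -- termwise bound
  have hterm : ∀ j j', (((κ j : ℂ) * (κ j' : ℂ)) * (star ψ ⬝ᵥ (((b j)ᴴ * b j') *ᵥ ψ))).re ≤
      (if j = j' then κ₀ ^ 2 * x j else 0) + κ₀ ^ 2 * (T j * T j') := by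
    intro j j'
    have hre := Complex.re_le_norm (((κ j : ℂ) * (κ j' : ℂ)) * (star ψ ⬝ᵥ (((b j)ᴴ * b j') *ᵥ ψ)))
    rw [norm_mul, norm_mul, Complex.norm_real, Complex.norm_real, Real.norm_eq_abs,
      Real.norm_eq_abs] at hre
    have hkk : |κ j| * |κ j'| ≤ κ₀ ^ 2 := by
      rw [sq]; exact mul_le_mul (hκ j) (hκ j') (abs_nonneg _) (hκ0 j)
    have hM0 := norm_nonneg (star ψ ⬝ᵥ (((b j)ᴴ * b j') *ᵥ ψ))
    by_cases hjj : j = j'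
    · subst hjj
      rw [if_pos rfl]
      have hsq := norm_blockPairCorrelation_sq_le_present hdis φ j j ψ
      have hM1 : ‖star ψ ⬝ᵥ (((b j)ᴴ * b j) *ᵥ ψ)‖ ≤ uu j := by
        apply abs_le_of_sq_le_sq' _ (hu0 j) |>.2
        · simpa only [sq_abs, Real.norm_eq_abs, abs_norm] using
            (show ‖star ψ ⬝ᵥ (((b j)ᴴ * b j) *ᵥ ψ)‖ ^ 2 ≤ uu j ^ 2 by rw [sq (uu j)]; exact hsq)
      have h3 : |κ j| * |κ j| * ‖star ψ ⬝ᵥ (((b j)ᴴ * b j) *ᵥ ψ)‖ ≤ κ₀ ^ 2 * x j :=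
        mul_le_mul hkk (hM1.trans (hux j)) hM0 (sq_nonneg _)
      nlinarith [mul_nonneg (sq_nonneg κ₀) (mul_nonneg (hT0 j) (hT0 j))]
    · rw [if_neg hjj, zero_add]
      have hM := norm_blockPairCorrelation_le_mul hωu hωd hdis φ hON hjj ψ
      change ‖star ψ ⬝ᵥ (((b j)ᴴ * b j') *ᵥ ψ)‖ ≤ t j * t j' at hM
      have hM' : ‖star ψ ⬝ᵥ (((b j)ᴴ * b j') *ᵥ ψ)‖ ≤ T j * T j' :=
        hM.trans (mul_le_mul (htT j) (htT j') (ht0 j') (hT0 j))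
      have h3 : |κ j| * |κ j'| * ‖star ψ ⬝ᵥ (((b j)ᴴ * b j') *ᵥ ψ)‖ ≤ κ₀ ^ 2 * (T j * T j') :=
        mul_le_mul hkk hM' hM0 (sq_nonneg _)
      linarith
  rw [hexp, Complex.re_sum]
  simp_rw [Complex.re_sum]
  calc ∑ j, ∑ j', (((κ j : ℂ) * (κ j' : ℂ)) * (star ψ ⬝ᵥ (((b j)ᴴ * b j') *ᵥ ψ))).re
      ≤ ∑ j, ∑ j', ((if j = j' then κ₀ ^ 2 * x j else 0) + κ₀ ^ 2 * (T j * T j')) :=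
        Finset.sum_le_sum fun j _ => Finset.sum_le_sum fun j' _ => hterm j j'
    _ = κ₀ ^ 2 * (∑ j, x j + (∑ j, T j) ^ 2) := by
        have hdiag : ∑ j, ∑ j', (if j = j' then κ₀ ^ 2 * x j else (0 : ℝ)) =
            κ₀ ^ 2 * ∑ j, x j := by
          simp only [Finset.sum_ite_eq, Finset.mem_univ, if_true, Finset.mul_sum]
        have hoff : ∑ j, ∑ j', κ₀ ^ 2 * (T j * T j') = κ₀ ^ 2 * (∑ j, T j) ^ 2 := by
          rw [sq (∑ j, T j), Finset.sum_mul_sum, Finset.mul_sum]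
          refine Finset.sum_congr rfl fun j _ => ?_
          rw [Finset.mul_sum]
        simp only [Finset.sum_add_distrib]
        rw [hdiag, hoff]
        ring

end Gram


/-! ### Registered stub: the Gram bound for the torus block maps -/

section StubB

open Classical

/-- **Registered stub** (`stub_coarseBlockModesGramBound`, crux stmt-HubbardSuperconductivity-18534):
the abstract block pair Gram bound for the block modes of the fermionic torus (corner `a`, side
`R ≤ L`): `‖(Σ_j κ_j c_↑(φ_j)c_↓(φ_j)) ψ‖² ≤ κ₀² (Σ_j x_j + (Σ_j (x_j(1-x_j))^{1/4})²)`.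
Bardeen–Cooper–Schrieffer (1957) §II; Yang (1962) §3. [folklore] -/
theorem stub_coarseBlockModesGramBound :
    ∀ (L : ℕ) [NeZero L] (a : TorusSite 2 L) (R : ℕ), R ≤ L →
      ∀ (φ : (Fin 2 → Fin R) → (Fin 2 → Fin R) → ℝ),
        (∀ j j', ∑ u, φ j u * φ j' u = if j = j' then 1 else 0) →
        ∀ (κ : (Fin 2 → Fin R) → ℝ) (κ₀ : ℝ), (∀ j, |κ j| ≤ κ₀) →
        ∀ (ψ : Fock (Orb (FermionTorus 2 L))), star ψ ⬝ᵥ ψ = 1 →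
          (star ((∑ j : Fin 2 → Fin R, (κ j : ℂ) •
              (annihilate (Function.extend (fun u : Fin 2 → Fin R =>
                  orb (FermionTorus.ofTorusSite (a + fun i => ((u i : ℕ) : ZMod L))) 0)
                  (fun u => ((φ j u : ℝ) : ℂ)) 0) *
                annihilate (Function.extend (fun u : Fin 2 → Fin R =>
                  orb (FermionTorus.ofTorusSite (a + fun i => ((u i : ℕ) : ZMod L))) 1)
                  (fun u => ((φ j u : ℝ) : ℂ)) 0))) *ᵥ ψ) ⬝ᵥ
            ((∑ j : Fin 2 → Fin R, (κ j : ℂ) •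
              (annihilate (Function.extend (fun u : Fin 2 → Fin R =>
                  orb (FermionTorus.ofTorusSite (a + fun i => ((u i : ℕ) : ZMod L))) 0)
                  (fun u => ((φ j u : ℝ) : ℂ)) 0) *
                annihilate (Function.extend (fun u : Fin 2 → Fin R =>
                  orb (FermionTorus.ofTorusSite (a + fun i => ((u i : ℕ) : ZMod L))) 1)
                  (fun u => ((φ j u : ℝ) : ℂ)) 0))) *ᵥ ψ)).re ≤
          κ₀ ^ 2 * ((∑ j : Fin 2 → Fin R, (star ψ ⬝ᵥ (numberMode (Function.extend
              (fun u : Fin 2 → Fin R =>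
                orb (FermionTorus.ofTorusSite (a + fun i => ((u i : ℕ) : ZMod L))) 0)
              (fun u => ((φ j u : ℝ) : ℂ)) 0) *ᵥ ψ)).re) +
            (∑ j : Fin 2 → Fin R, Real.sqrt (Real.sqrt
              ((star ψ ⬝ᵥ (numberMode (Function.extend
                  (fun u : Fin 2 → Fin R =>
                    orb (FermionTorus.ofTorusSite (a + fun i => ((u i : ℕ) : ZMod L))) 0)
                  (fun u => ((φ j u : ℝ) : ℂ)) 0) *ᵥ ψ)).re *
                (1 - (star ψ ⬝ᵥ (numberMode (Function.extend
                  (fun u : Fin 2 → Fin R =>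
                    orb (FermionTorus.ofTorusSite (a + fun i => ((u i : ℕ) : ZMod L))) 0)
                  (fun u => ((φ j u : ℝ) : ℂ)) 0) *ᵥ ψ)).re)))) ^ 2) := by
  intro L _ a R hRL φ hON κ κ₀ hκ ψ hψ
  have h := re_star_sum_smul_pair_mulVec_le (blockOrb_injective a hRL 0) (blockOrb_injective a hRL 1)
    (fun u v => orb_ne_of_spin_ne _ _) φ hON κ κ₀ hκ ψ hψ
  beta_reduce at h
  exact h

end StubB

end Summit.HubbardSuperconductivity.HubbardSuperconductivity.Theorems.CoarseTightness

end
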